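import Literature.NumberTheory.EllipticCurves.ClassPolynomialNegOneTwentyThree
import Literature.NumberTheory.EllipticCurves.KleinJCuspExpansionWide
import HarnessLib

/-!
# The class polynomial of discriminant `−51`: `H_{−51}(X) = X² + 5541101568·X + 6262062317568`, and the singular moduli
# `j((−1+√−51)/2) = −2770550784 − 671956992√17`, `j(τ_{(3,3,5)}) = −2770550784 + 671956992√17`

certified instances and evidence bearing on the general Hodge conjecture; no claim.

Topic `NumberTheory/EllipticCurves` (singular moduli); theorem-only file (no definition, no named fact; D-0026), in the tree's vocabulary
`classPolynomial D = ∏_{Q ∈ reducedForms D} (X − j(τ_Q))`, `formJ Q = j(τ_Q)`, `τ_Q = heegnerTau Q`.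
PRINTED. N. Ishii, *Trace of Frobenius endomorphism of an elliptic curve with complex multiplication*, Bull. Austral. Math. Soc. 70 (2004)
= arXiv:math/0401289, §3 table 'h(R) = 2', row `d(R) = −51` (held text p. 5, lines 68 and 70): "`x² + 5541101568x + 6262062317568`",
"`−2770550784 − 671956992√17`" (here Ishii's printed `j` is the root of LARGE modulus, `j(𝒪_K)`; the table of class equations is M. Kaneko's).
METHOD (OURS) — the `3`-ISOGENY between the two ideal classes, run inside the kernel (third level-3 instance of the method of
`ClassPolynomialNegForty`, after `ClassPolynomialNegOneTwentyThree` and `…NegTwoSixtySeven`), on the WIDER cusp disc. (1) `reducedForms (−51) =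
{(1,1,13), (3,3,5)}` (Cox Thm. 2.13; `decide +kernel`). (2) `(τ_{(1,1,13)} + 2)/3 = τ_{(9,−9,15)} = τ_{(3,−3,5)} = τ_{(3,3,5)} − 1` (the prime above the
ramified `3` is the non-principal class), so `j₂ = j(τ_{(3,3,5)})` lies in the fibre `Φ₃(x, j₁) = ∏_σ (x − j(στ₁))` over `j₁ = j(τ_{(1,1,13)})`
(`ModularPolynomialThree.eval_kleinJ_eq_prod`, Cox (11.14)–(11.15)): `Φ₃(j₂, j₁) = 0` with the tree's explicit `Φ₃` (`intModularPolynomial_three_eval`,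
Cox (11.22)). (3) SYMMETRIC REDUCTION `Φ₃(x, y) = G₃(x + y, xy)` and the INTEGER POINTS of `G₃ = 0` (`= X₀⁺(3)`, genus 0, one cusp): `s = A(u) =
u³ + 36u² − 1916u − 50976`, `p = B(u) = u⁴ + 792u³ + 221400u² + 24690528u + 803894544` with `u ∈ ℤ` whenever `S, P ∈ ℤ`, `G₃(S,P) = 0`, `D(S,P) ≠ 0`
— this is `ClassPolynomialNegOneTwentyThree.exists_int_param_of_G3_eq_zero`, REUSED (imported, not restated). (4) INTEGRALITY of `s = j₁ + j₂`,
`p = j₁j₂` (tree: `minpoly_formJ_map_eq_classPolynomial`, `isIntegral_int_formJ`; Mathlib `minpoly.isIntegrallyClosed_eq_field_fractions'`).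
(5) ONE NUMERIC PIN on the WIDER cusp disc: the nomes at `τ₁ = (−1+i√51)/2`, `τ₂ = (−3+i√51)/6` are the negative reals `−e^{−π√51}`,
`−e^{−π√51/3}`, the latter of modulus `≈ 5.65·10⁻⁴ ≤ 10⁻³` (NOT `≤ 10⁻⁴`), so the wide cusp estimate `|j − 1/q − 744| ≤ 5.25·10⁵|q|`
(`KleinJCuspExpansionWide`) applies at BOTH points: `|S + F³ + F − 1488| ≤ 296.7001`, `F = e^{π√51/3}`; the kernel inequality
`1769.5 ≤ e^{π√51/3} ≤ 1769.62` (`Real.pi_gt_d6`/`pi_lt_d6`, `√51` by squaring, `Real.exp_one_gt_d9`/`lt_d9`, ten Taylor terms via `Real.exp_bound`;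
no floating point) gives `|S − A(−1782)| ≤ 566606`, while `A(u) − A(u₀) = (u − u₀)Q`, `Q ≥ ¼(3u₀² + 72u₀ − 8960) = 2347327`: `u = −1782`.
`D(S,P) ≠ 0` since `|189·S·P|` dominates (`S < −5.54·10⁹`, `|P| = |j₁||j₂| ≥ 4·10¹²`). (6) `(2j₁ − s)² = s² − 4p = 17·1343913984²` and
`|j₁| > 5·10⁹` select the root.
LIMITS. Kernel-checked instance of a printed table row (`H_{−51}` [Ishii2004 §3]) by the 3-isogeny symmetric-reduction method (`X₀⁺(3)`
parametrisation, integer point `u = −1782`) with a kernel numeric pin on the wider cusp disc; third level-3 instance of method class M3, reusing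
anchor 136's integer-point lemma and anchor 145's wide cusp lemma; theorem-only; no census number changes; nothing about HC.
References: [Ishii2004] §3; [Cox2013] Thm. 2.13, §11.B (11.14)–(11.15)/Lemma 11.24, §11.C (11.22)/Thm. 11.18, Thm. 11.1, §13.A Prop. 13.2;
[GranvilleStark2000] §2 (`|1/q| = e^{π√d/a}`). -/

noncomputable section

open Complex Polynomial
open UpperHalfPlane hiding I
open scoped Real

namespace Literature.NumberTheory.EllipticCurves

open ModularForms
open Literature.NumberTheory.QuadraticFields.BinaryQuadraticForm (reducedForms)
open Literature.NumberTheory.QuadraticFields.Quadratic (BinQF)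

namespace ClassPolynomialNegFiftyOne

/-- **The pin on the integer parameter**: `S = A(u)` with `|S − A(−1782)| < 2347327 = ¼(3u₀² + 72u₀ − 8960)` forces `u = −1782`, since
`A(u) − A(u₀) = (u − u₀)(u² + uu₀ + u₀² + 36(u + u₀) − 1916)` and the quadratic factor is `≥ 2347327`. [folklore] -/
private theorem eq_of_window {S u : ℤ} (hS : S = u ^ 3 + 36 * u ^ 2 - 1916 * u - 50976)
    (hlo : -5541662840 ≤ S) (hhi : S ≤ -5540534962) : u = -1782 := by
  have hQ : (2347327 : ℤ) ≤ u ^ 2 + u * (-1782) + (-1782) ^ 2 + 36 * (u + (-1782)) - 1916 := by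
    nlinarith [sq_nonneg (2 * u + (-1782) + 36)]
  have hfac : S - (-5541101568) = (u - (-1782)) * (u ^ 2 + u * (-1782) + (-1782) ^ 2 + 36 * (u + (-1782)) - 1916) := by
    rw [hS]; ring
  rcases lt_trichotomy u (-1782) with h | h | h
  · nlinarith [show u - (-1782) ≤ -1 by omega]
  · exact h
  · nlinarith [show (1 : ℤ) ≤ u - (-1782) by omega]

/-- **`(τ₁ + 2)/3 ↔ τ₂`**: `j((τ_{(1,1,13)} + 2)/3) = j(τ_{(9,−9,15)}) = j(τ_{(3,−3,5)}) = j(τ_{(3,3,5)})` — the two classes of discriminant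
`−51` are `3`-isogenous. [cite: Cox2013, §11.B (11.14)–(11.15) and Lemma 11.24] -/
theorem kleinJ_divPoint_three_two : kleinJ (divPoint 3 2 (heegnerTau (1, 1, 13))) = formJ (3, 3, 5) := by
  have h := ModularPolynomialThree.divPoint_three_heegnerTau_of_pos (a := 1) (b := 1) (c := 13) one_pos (by norm_num) 2
  norm_num at h
  have h2 : heegnerTau ((9 : ℤ), (-9 : ℤ), (15 : ℤ)) = heegnerTau (3, -3, 5) := by
    apply UpperHalfPlane.ext
    rw [coe_heegnerTau_eq (Q := ((9 : ℤ), (-9 : ℤ), (15 : ℤ))) (D := 9 * (-51)) (by norm_num) (by norm_num) (by norm_num),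
      coe_heegnerTau_eq (Q := ((3 : ℤ), (-3 : ℤ), (5 : ℤ))) (D := -51) (by norm_num) (by norm_num) (by norm_num), sqrtDisc_nine_mul]
    push_cast; ring
  have h3 : formJ (3, -3, 5) = formJ (3, 3, 5) := by
    simpa [BinQF.act] using formJ_eq_formJ_act ⟨3, -3, 5⟩ (by norm_num) (by norm_num [BinQF.disc]) (p := 1) (q := 1) (r := 0) (s := 1) (by norm_num)
  rw [h, h2, ← formJ_eq_kleinJ, h3]

/-- **`Φ₃(j₂, j₁) = 0` in symmetric form `G₃(j₁ + j₂, j₁j₂) = 0`**, `j₁ = j(τ_{(1,1,13)})`, `j₂ = j(τ_{(3,3,5)})`. [cite: Cox2013, §11.B (11.14)–(11.15) and §11.C (11.22)] -/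
theorem G3_formJ_eq_zero :
    -(formJ (1, 1, 13) * formJ (3, 3, 5)) ^ 3 + 2590058000 * (formJ (1, 1, 13) * formJ (3, 3, 5)) ^ 2 +
        2232 * (formJ (1, 1, 13) + formJ (3, 3, 5)) * (formJ (1, 1, 13) * formJ (3, 3, 5)) ^ 2 -
        1069960 * (formJ (1, 1, 13) + formJ (3, 3, 5)) ^ 2 * (formJ (1, 1, 13) * formJ (3, 3, 5)) +
        8900112384000 * (formJ (1, 1, 13) + formJ (3, 3, 5)) * (formJ (1, 1, 13) * formJ (3, 3, 5)) -
        771751936000000000 * (formJ (1, 1, 13) * formJ (3, 3, 5)) + (formJ (1, 1, 13) + formJ (3, 3, 5)) ^ 4 +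
        36864000 * (formJ (1, 1, 13) + formJ (3, 3, 5)) ^ 3 + 452984832000000 * (formJ (1, 1, 13) + formJ (3, 3, 5)) ^ 2 +
        1855425871872000000000 * (formJ (1, 1, 13) + formJ (3, 3, 5)) = 0 := by
  have h := ModularPolynomialThree.eval_kleinJ_eq_prod (formJ (3, 3, 5)) (heegnerTau (1, 1, 13))
  rw [intModularPolynomial_three_eval, kleinJ_divPoint_three_two, ← formJ_eq_kleinJ (1, 1, 13), sub_self, mul_zero, mul_zero,
    mul_zero] at h
  linear_combination h

/-- `√(−(−51)) = √51`. [folklore] -/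
private theorem sqrt_neg_neg : Real.sqrt (-((-51 : ℤ) : ℝ)) = √(51 : ℝ) := by norm_num
/-- **The nome at `τ₂ = τ_{(3,3,5)} = (−3 + i√51)/6` is the negative real `−e^{−π√51/3}`.**
[cite: GranvilleStark2000, §2 proof of Theorem 1 (`|1/q| = e^{π√d/a}`, here `a = 3`)] -/
theorem qParam_heegnerTau_three_three_five :
    Function.Periodic.qParam 1 (heegnerTau (3, 3, 5) : ℂ) = -(Real.exp (-(π * √(51 : ℝ) / 3)) : ℂ) := by
  rw [qParam_one_eq_cexp, coe_heegnerTau_eq (Q := ((3 : ℤ), (3 : ℤ), (5 : ℤ))) (D := -51) (by norm_num) (by norm_num) (by norm_num),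
    sqrtDisc, sqrt_neg_neg]
  have harg : 2 * (π : ℂ) * Complex.I * ((Complex.I * (√(51 : ℝ) : ℂ) - ((3 : ℤ) : ℂ)) / (2 * ((3 : ℤ) : ℂ))) =
      ((-(π * √(51 : ℝ) / 3) : ℝ) : ℂ) - π * Complex.I := by
    push_cast
    linear_combination ((π : ℂ) * (√(51 : ℝ) : ℂ) / 3) * Complex.I_mul_I
  rw [harg, Complex.exp_sub, Complex.exp_pi_mul_I, ← Complex.ofReal_exp, div_neg, div_one]

/-- **The nome at `τ₁ = τ_{(1,1,13)} = (−1 + i√51)/2` is the negative real `−e^{−π√51}`.**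
[cite: GranvilleStark2000, §2 proof of Theorem 1 (`|1/q| = e^{π√d}`)] -/
theorem qParam_heegnerTau_one_one_thirteen :
    Function.Periodic.qParam 1 (heegnerTau (1, 1, 13) : ℂ) = -(Real.exp (-(π * √(51 : ℝ))) : ℂ) := by
  rw [qParam_one_eq_cexp, coe_heegnerTau_eq (Q := ((1 : ℤ), (1 : ℤ), (13 : ℤ))) (D := -51) (by norm_num) (by norm_num) (by norm_num),
    sqrtDisc, sqrt_neg_neg]
  have harg : 2 * (π : ℂ) * Complex.I * ((Complex.I * (√(51 : ℝ) : ℂ) - ((1 : ℤ) : ℂ)) / (2 * ((1 : ℤ) : ℂ))) =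
      ((-(π * √(51 : ℝ)) : ℝ) : ℂ) - π * Complex.I := by
    push_cast
    linear_combination ((π : ℂ) * (√(51 : ℝ) : ℂ)) * Complex.I_mul_I
  rw [harg, Complex.exp_sub, Complex.exp_pi_mul_I, ← Complex.ofReal_exp, div_neg, div_one]

/-- `e^{π√51} = (e^{π√51/3})³`. [folklore] -/
private theorem exp_pi_sqrt_eq_cube : Real.exp (π * √(51 : ℝ)) = Real.exp (π * √(51 : ℝ) / 3) ^ 3 := by rw [← Real.exp_nat_mul]; congr 1; ring

/-- **The numeric pin `1769.5 ≤ e^{π√51/3} ≤ 1769.62`** (true value `1769.5602…`): `Real.pi_gt_d6`/`pi_lt_d6` and `7.1414284285 < √51 < 7.1414284286`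
give `7.478484 ≤ π√51/3 ≤ 7.478488`; `e^x = (e¹)⁷·e^{x−7}` with `Real.exp_one_gt_d9`/`lt_d9` and ten Taylor terms (`Real.exp_bound`). [folklore] -/
private theorem exp_bounds : (1769.5 : ℝ) ≤ Real.exp (π * √(51 : ℝ) / 3) ∧ Real.exp (π * √(51 : ℝ) / 3) ≤ 1769.62 := by
  have hs1 : (7.1414284285 : ℝ) < √(51 : ℝ) := (Real.lt_sqrt (by norm_num)).mpr (by norm_num)
  have hs2 : √(51 : ℝ) < 7.1414284286 := (Real.sqrt_lt' (by norm_num)).mpr (by norm_num)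
  have hπ1 : (3.141592 : ℝ) < π := Real.pi_gt_d6
  have hπ2 : π < 3.141593 := Real.pi_lt_d6
  have hx1 : (7.478484 : ℝ) ≤ π * √(51 : ℝ) / 3 := by nlinarith [mul_nonneg (sub_nonneg.mpr hπ1.le) (sub_nonneg.mpr hs1.le)]
  have hx2 : π * √(51 : ℝ) / 3 ≤ 7.478488 := by nlinarith [mul_nonneg (sub_nonneg.mpr hπ2.le) (sub_nonneg.mpr hs2.le)]
  have he1 : (2.7182818283 : ℝ) < Real.exp 1 := Real.exp_one_gt_d9
  have he2 : Real.exp 1 < (2.7182818286 : ℝ) := Real.exp_one_lt_d9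
  have h7pos := pow_pos (Real.exp_pos (1 : ℝ)) 7
  constructor
  · refine le_trans ?_ (Real.exp_le_exp.mpr hx1)
    have hsplit : Real.exp (7.478484 : ℝ) = Real.exp 1 ^ 7 * Real.exp (0.478484 : ℝ) := by rw [← Real.exp_nat_mul, ← Real.exp_add]; norm_num
    have hy : |(0.478484 : ℝ)| ≤ 1 := by rw [abs_of_pos (by norm_num)]; norm_num
    have hT := Real.exp_bound hy (n := 10) (by norm_num)
    simp only [Finset.sum_range_succ, Finset.sum_range_zero, Nat.factorial, Nat.succ_eq_add_one] at hT
    norm_num at hT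
    have h7 : (2.7182818283 : ℝ) ^ 7 ≤ Real.exp 1 ^ 7 := pow_le_pow_left₀ (by norm_num) he1.le 7
    rw [hsplit]; nlinarith [(abs_sub_le_iff.1 hT).2, Real.exp_pos (0.478484 : ℝ)]
  · refine le_trans (Real.exp_le_exp.mpr hx2) ?_
    have hsplit : Real.exp (7.478488 : ℝ) = Real.exp 1 ^ 7 * Real.exp (0.478488 : ℝ) := by rw [← Real.exp_nat_mul, ← Real.exp_add]; norm_num
    have hy : |(0.478488 : ℝ)| ≤ 1 := by rw [abs_of_pos (by norm_num)]; norm_num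
    have hT := Real.exp_bound hy (n := 10) (by norm_num)
    simp only [Finset.sum_range_succ, Finset.sum_range_zero, Nat.factorial, Nat.succ_eq_add_one] at hT
    norm_num at hT
    have h7 : Real.exp 1 ^ 7 ≤ (2.7182818286 : ℝ) ^ 7 := pow_le_pow_left₀ (Real.exp_pos _).le he2.le 7
    rw [hsplit]; nlinarith [(abs_sub_le_iff.1 hT).1, Real.exp_pos (0.478488 : ℝ)]

/-- **`|j(τ_{(3,3,5)}) + e^{π√51/3} − 744| ≤ 5.25·10⁵·e^{−π√51/3}`**: the WIDE cusp estimate at `τ₂` (`|q| = e^{−π√51/3} ≈ 5.65·10⁻⁴ ≤ 10⁻³`,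
outside the tree's `10⁻⁴` disc). [cite: GranvilleStark2000, §2 proof of Theorem 1] -/
theorem norm_formJ_three_three_five_add_le :
    ‖formJ (3, 3, 5) + (Real.exp (π * √(51 : ℝ) / 3) : ℂ) - 744‖ ≤ 525000 * Real.exp (-(π * √(51 : ℝ) / 3)) := by
  have hq := qParam_heegnerTau_three_three_five
  have hqn : ‖Function.Periodic.qParam 1 (heegnerTau (3, 3, 5) : ℂ)‖ = Real.exp (-(π * √(51 : ℝ) / 3)) := by
    rw [hq, norm_neg, Complex.norm_real, Real.norm_eq_abs, abs_of_pos (Real.exp_pos _)]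
  have hq3 : ‖Function.Periodic.qParam 1 (heegnerTau (3, 3, 5) : ℂ)‖ ≤ 1 / 10 ^ 3 := by
    rw [hqn, Real.exp_neg, inv_le_comm₀ (Real.exp_pos _) (by norm_num), show (1 / (10 : ℝ) ^ 3)⁻¹ = 10 ^ 3 by norm_num]
    linarith [exp_bounds.1]
  have hj : formJ (3, 3, 5) = ModularForm.E₄ (heegnerTau (3, 3, 5)) ^ 3 / ModularForm.discriminant (heegnerTau (3, 3, 5)) := by
    rw [formJ_eq_kleinJ]; rfl
  have hcusp := norm_E₄_cube_div_discriminant_sub_sub_le_wide (heegnerTau (3, 3, 5)) hq3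
  rw [← hj, hqn, hq, inv_neg, ← Complex.ofReal_inv, Real.exp_neg, inv_inv, sub_neg_eq_add] at hcusp
  rw [Real.exp_neg]; exact hcusp

/-- **`|j(τ_{(1,1,13)}) + e^{π√51} − 744| ≤ 5.25·10⁵·e^{−π√51}`**: the wide cusp estimate at `τ₁` (`|q| = e^{−π√51}`).
[cite: GranvilleStark2000, §2 proof of Theorem 1] -/
theorem norm_formJ_one_one_thirteen_add_le :
    ‖formJ (1, 1, 13) + (Real.exp (π * √(51 : ℝ)) : ℂ) - 744‖ ≤ 525000 * Real.exp (-(π * √(51 : ℝ))) := by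
  have hq := qParam_heegnerTau_one_one_thirteen
  have hqn : ‖Function.Periodic.qParam 1 (heegnerTau (1, 1, 13) : ℂ)‖ = Real.exp (-(π * √(51 : ℝ))) := by
    rw [hq, norm_neg, Complex.norm_real, Real.norm_eq_abs, abs_of_pos (Real.exp_pos _)]
  have hE3 : (10 ^ 3 : ℝ) ≤ Real.exp (π * √(51 : ℝ)) := by
    rw [exp_pi_sqrt_eq_cube]; nlinarith [exp_bounds.1, pow_pos (Real.exp_pos (π * √(51 : ℝ) / 3)) 2]
  have hq3 : ‖Function.Periodic.qParam 1 (heegnerTau (1, 1, 13) : ℂ)‖ ≤ 1 / 10 ^ 3 := by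
    rwa [hqn, Real.exp_neg, inv_le_comm₀ (Real.exp_pos _) (by norm_num), show (1 / (10 : ℝ) ^ 3)⁻¹ = 10 ^ 3 by norm_num]
  have hj : formJ (1, 1, 13) = ModularForm.E₄ (heegnerTau (1, 1, 13)) ^ 3 / ModularForm.discriminant (heegnerTau (1, 1, 13)) := by
    rw [formJ_eq_kleinJ]; rfl
  have hcusp := norm_E₄_cube_div_discriminant_sub_sub_le_wide (heegnerTau (1, 1, 13)) hq3
  rw [← hj, hqn, hq, inv_neg, ← Complex.ofReal_inv, Real.exp_neg, inv_inv, sub_neg_eq_add] at hcusp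
  rw [Real.exp_neg]; exact hcusp

/-- **`|j(τ_{(1,1,13)})| ≥ e^{π√51} − 744.0001`** (window at `τ₁`, `F ≥ 1769.5`). [cite: GranvilleStark2000, §2 proof of Theorem 1] -/
theorem le_norm_formJ_one_one_thirteen : Real.exp (π * √(51 : ℝ) / 3) ^ 3 - 744.0001 ≤ ‖formJ (1, 1, 13)‖ := by
  have hw1 := norm_formJ_one_one_thirteen_add_le
  obtain ⟨hF1, -⟩ := exp_bounds
  rw [Real.exp_neg, exp_pi_sqrt_eq_cube] at hw1
  set F := Real.exp (π * √(51 : ℝ) / 3)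
  have hF3 : (1769.5 : ℝ) ^ 3 ≤ F ^ 3 := pow_le_pow_left₀ (by norm_num) hF1 3
  have hb1 : 525000 * (F ^ 3)⁻¹ ≤ 1 / 10000 := by rw [← div_eq_mul_inv, div_le_iff₀ (by positivity)]; nlinarith
  have htri : ‖-((F : ℂ) ^ 3) + 744‖ ≤ ‖formJ (1, 1, 13)‖ + ‖formJ (1, 1, 13) + (F : ℂ) ^ 3 - 744‖ := by
    have e : -((F : ℂ) ^ 3) + 744 = formJ (1, 1, 13) - (formJ (1, 1, 13) + (F : ℂ) ^ 3 - 744) := by ring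
    rw [e]; exact norm_sub_le _ _
  have hval : ‖-((F : ℂ) ^ 3) + 744‖ = F ^ 3 - 744 := by
    rw [show -((F : ℂ) ^ 3) + 744 = ((-(F ^ 3) + 744 : ℝ) : ℂ) by push_cast; ring, Complex.norm_real, Real.norm_eq_abs, abs_of_neg (by nlinarith)]
    ring
  push_cast at hw1
  linarith

/-- `reducedForms (−51) = {(1,1,13), (3,3,5)}` (`h(−51) = 2`). [cite: Cox2013, Thm. 2.13] -/
theorem reducedForms_neg_51 : reducedForms (-51) = {((1 : ℤ), (1 : ℤ), (13 : ℤ)), (3, 3, 5)} := by decide +kernel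

/-- **`H_{−51}` is the image in `ℂ[X]` of `minpoly_ℤ(j(τ_{(1,1,13)}))`** (integer coefficients: Cox Prop. 13.2 with Thm. 11.1 (i)).
[cite: Cox2013, §13.A Prop. 13.2 (with Thm. 11.1 (i))] -/
theorem classPolynomial_neg_51_eq_map_minpoly_int :
    classPolynomial (-51) = (minpoly ℤ (formJ (1, 1, 13))).map (algebraMap ℤ ℂ) := by
  have hD : (-51 : ℤ) < 0 := by norm_num
  have hint : IsIntegral ℤ (formJ (1, 1, 13)) :=
    isIntegral_int_formJ (Q := ((1 : ℤ), (1 : ℤ), (13 : ℤ))) (by decide) (by decide) (by decide)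
  have hmin := minpoly_formJ_map_eq_classPolynomial (D := -51) (Q := ((1 : ℤ), (1 : ℤ), (13 : ℤ))) hD
    (by rw [reducedForms_neg_51]; simp)
  rw [← hmin, minpoly.isIntegrallyClosed_eq_field_fractions' ℚ hint, Polynomial.map_map]
  congr 1

/-- **`j₁ + j₂ ∈ ℤ` and `j₁j₂ ∈ ℤ`**: the coefficients of `H_{−51} = (X − j₁)(X − j₂) ∈ ℤ[X]`. [cite: Cox2013, §13.A Prop. 13.2 (with Thm. 11.1 (i))] -/
theorem exists_int_trace_norm :
    ∃ S P : ℤ, formJ (1, 1, 13) + formJ (3, 3, 5) = S ∧ formJ (1, 1, 13) * formJ (3, 3, 5) = P := by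
  set M := minpoly ℤ (formJ (1, 1, 13)) with hM
  have h := classPolynomial_neg_51_eq_map_minpoly_int
  rw [classPolynomial, reducedForms_neg_51, Finset.prod_pair (by decide)] at h
  have hprod : (X - C (formJ (1, 1, 13))) * (X - C (formJ (3, 3, 5))) =
      X ^ 2 - C (formJ (1, 1, 13) + formJ (3, 3, 5)) * X + C (formJ (1, 1, 13) * formJ (3, 3, 5)) := by
    rw [C_add, C_mul]; ring
  rw [hprod] at h
  have h1 := congr_arg (fun p : ℂ[X] => p.coeff 1) h
  have h0 := congr_arg (fun p : ℂ[X] => p.coeff 0) h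
  simp only [coeff_add, coeff_sub, coeff_X_pow, coeff_C_mul, coeff_X, coeff_C, coeff_map, eq_intCast] at h1 h0
  norm_num at h1 h0
  refine ⟨-(M.coeff 1), M.coeff 0, ?_, ?_⟩
  · push_cast; linear_combination -h1
  · exact_mod_cast h0

/-- **Trace and norm: `j₁ + j₂ = −5541101568`, `j₁j₂ = 6262062317568`** — the coefficients of the printed `x² + 5541101568x + 6262062317568`,
derived in the kernel by steps (2)–(5) of the module docstring. [cite: Ishii2004, §3 (table h(R) = 2, row d(R) = −51; held text p. 5 line 68)] -/
theorem formJ_add_and_mul :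
    formJ (1, 1, 13) + formJ (3, 3, 5) = -5541101568 ∧ formJ (1, 1, 13) * formJ (3, 3, 5) = 6262062317568 := by
  obtain ⟨S, P, hS, hP⟩ := exists_int_trace_norm
  have hw1 := norm_formJ_one_one_thirteen_add_le
  have hw2 := norm_formJ_three_three_five_add_le
  have hn1 := le_norm_formJ_one_one_thirteen
  obtain ⟨hF1, hF2⟩ := exp_bounds
  rw [Real.exp_neg] at hw1 hw2
  rw [exp_pi_sqrt_eq_cube] at hw1
  set F := Real.exp (π * √(51 : ℝ) / 3) with hFdef
  have hF3 : (1769.5 : ℝ) ^ 3 ≤ F ^ 3 := pow_le_pow_left₀ (by norm_num) hF1 3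
  have hFpos : 0 < F := Real.exp_pos _
  have hF3hi : F ^ 3 ≤ (1769.62 : ℝ) ^ 3 := pow_le_pow_left₀ hFpos.le hF2 3
  have hF3pos : 0 < F ^ 3 := pow_pos hFpos 3
  have hb1 : 525000 * (F ^ 3)⁻¹ ≤ 1 / 10000 := by rw [← div_eq_mul_inv, div_le_iff₀ hF3pos]; nlinarith
  have hb2 : 525000 * F⁻¹ ≤ 296.7 := by rw [← div_eq_mul_inv, div_le_iff₀ hFpos]; nlinarith
  have hn2 : F - 1040.7 ≤ ‖formJ (3, 3, 5)‖ := by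
    have htri : ‖-(F : ℂ) + 744‖ ≤ ‖formJ (3, 3, 5)‖ + ‖formJ (3, 3, 5) + (F : ℂ) - 744‖ := by
      have e : -(F : ℂ) + 744 = formJ (3, 3, 5) - (formJ (3, 3, 5) + (F : ℂ) - 744) := by ring
      rw [e]; exact norm_sub_le _ _
    have hval : ‖-(F : ℂ) + 744‖ = F - 744 := by
      rw [show -(F : ℂ) + 744 = ((-F + 744 : ℝ) : ℂ) by push_cast; ring, Complex.norm_real, Real.norm_eq_abs, abs_of_neg (by linarith)]; ring
    linarith
  have htr : ‖((S : ℂ)) - ((-(F ^ 3) - F + 1488 : ℝ) : ℂ)‖ ≤ 296.7001 := by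
    have e : (S : ℂ) - ((-(F ^ 3) - F + 1488 : ℝ) : ℂ) = (formJ (1, 1, 13) + (F : ℂ) ^ 3 - 744) + (formJ (3, 3, 5) + (F : ℂ) - 744) := by
      rw [← hS]; push_cast; ring
    rw [e]; push_cast at hw1; exact (norm_add_le _ _).trans (by linarith)
  have e : ((S : ℂ)) - ((-(F ^ 3) - F + 1488 : ℝ) : ℂ) = (((S : ℝ) - (-(F ^ 3) - F + 1488) : ℝ) : ℂ) := by push_cast; ring
  rw [e, Complex.norm_real, Real.norm_eq_abs] at htr
  obtain ⟨hlo', hhi'⟩ := abs_le.mp htr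
  have hlo : (-5541662840 : ℤ) ≤ S := by exact_mod_cast (by linarith : (-5541662840 : ℝ) ≤ S)
  have hhi : S ≤ (-5540534962 : ℤ) := by exact_mod_cast (by linarith : (S : ℝ) ≤ -5540534962)
  have hPabs : (4 * 10 ^ 12 : ℤ) ≤ |P| := by
    have h : (4 * 10 ^ 12 : ℝ) ≤ ‖(P : ℂ)‖ := by
      rw [← hP, norm_mul]
      calc (4 * 10 ^ 12 : ℝ) ≤ (F ^ 3 - 744.0001) * (F - 1040.7) := by nlinarith
        _ ≤ ‖formJ (1, 1, 13)‖ * ‖formJ (3, 3, 5)‖ := mul_le_mul hn1 hn2 (by linarith) (norm_nonneg _)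
    rw [Complex.norm_intCast] at h
    exact_mod_cast h
  have hG : -P ^ 3 + 2590058000 * P ^ 2 + 2232 * S * P ^ 2 - 1069960 * S ^ 2 * P + 8900112384000 * S * P - 771751936000000000 * P +
      S ^ 4 + 36864000 * S ^ 3 + 452984832000000 * S ^ 2 + 1855425871872000000000 * S = 0 := by
    have h := G3_formJ_eq_zero
    rw [hS, hP] at h
    exact_mod_cast h
  have hD : 49025 * S ^ 2 - 189 * S * P + 5285632608000 * S - 22021395500 * P - 21929132032000000000 ≠ 0 := by
    have hSneg : 0 ≤ -S - 5540534962 := by linarith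
    have hSlo : 0 ≤ S + 5541662840 := by linarith
    rcases le_abs.mp hPabs with h | h
    · nlinarith [mul_nonneg hSneg (by linarith : 0 ≤ P - 4 * 10 ^ 12), mul_nonneg hSneg hSlo]
    · nlinarith [mul_nonneg hSneg (by linarith : 0 ≤ -P - 4 * 10 ^ 12), mul_nonneg hSneg hSlo]
  obtain ⟨u, hSu, hPu⟩ := ClassPolynomialNegOneTwentyThree.exists_int_param_of_G3_eq_zero hG hD
  have hu := eq_of_window hSu hlo hhi
  subst hu
  norm_num at hSu hPu
  exact ⟨by rw [hS, hSu]; norm_num, by rw [hP, hPu]; norm_num⟩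

/-- `(√17)² = 17` in `ℂ`. [folklore] -/
private theorem sqrt_seventeen_sq : ((√(17 : ℝ) : ℝ) : ℂ) ^ 2 = 17 := by
  rw [← Complex.ofReal_pow, Real.sq_sqrt (by norm_num)]; norm_num

/-- **`j((−1 + √−51)/2) = −2770550784 − 671956992√17`** (Ishii's printed `j` for `d(R) = −51`, verbatim: the root of `H_{−51}` of modulus `> 5·10⁹`;
the conjugate root has modulus `< 10⁵`). [cite: Ishii2004, §3 (row d(R) = −51, held text p. 5 lines 68–70)] -/
theorem formJ_one_one_thirteen_eq : formJ (1, 1, 13) = -2770550784 - 671956992 * (√(17 : ℝ) : ℂ) := by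
  obtain ⟨hs, hp⟩ := formJ_add_and_mul
  have hsq : (2 * formJ (1, 1, 13) + 5541101568) ^ 2 = (1343913984 * (√(17 : ℝ) : ℂ)) ^ 2 := by
    have hj2 : formJ (3, 3, 5) = -5541101568 - formJ (1, 1, 13) := by linear_combination hs
    rw [hj2] at hp
    linear_combination (-4 : ℂ) * hp - 1343913984 ^ 2 * sqrt_seventeen_sq
  rcases sq_eq_sq_iff_eq_or_eq_neg.mp hsq with h | h
  · exfalso
    have hj : formJ (1, 1, 13) = ((-2770550784 + 671956992 * √(17 : ℝ) : ℝ) : ℂ) := by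
      push_cast; linear_combination (1 / 2 : ℂ) * h
    have hn : (5 * 10 ^ 9 : ℝ) ≤ ‖formJ (1, 1, 13)‖ := by
      have h1 := le_norm_formJ_one_one_thirteen
      nlinarith [pow_le_pow_left₀ (by norm_num) exp_bounds.1 3]
    rw [hj, Complex.norm_real, Real.norm_eq_abs] at hn
    have hs1 : (4.123 : ℝ) < √(17 : ℝ) := (Real.lt_sqrt (by norm_num)).mpr (by norm_num)
    have hs2 : √(17 : ℝ) < 4.1232 := (Real.sqrt_lt' (by norm_num)).mpr (by norm_num)
    have hlt : |(-2770550784 + 671956992 * √(17 : ℝ) : ℝ)| < 5 * 10 ^ 9 := by rw [abs_lt]; constructor <;> linarith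
    linarith
  · linear_combination (1 / 2 : ℂ) * h

/-- **`j(τ_{(3,3,5)}) = −2770550784 + 671956992√17`** (the conjugate root, of modulus `< 10⁵`). [cite: Ishii2004, §3 (row d(R) = −51, held text p. 5 line 68)] -/
theorem formJ_three_three_five_eq : formJ (3, 3, 5) = -2770550784 + 671956992 * (√(17 : ℝ) : ℂ) := by
  linear_combination formJ_add_and_mul.1 - formJ_one_one_thirteen_eq

end ClassPolynomialNegFiftyOne

open ClassPolynomialNegFiftyOne

/-- **`H_{−51}(X) = X² + 5541101568·X + 6262062317568`**: the class polynomial of discriminant `−51` (`h(−51) = 2`, reduced forms `(1,1,13)`,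
`(3,3,5)`), as a kernel theorem about the tree's `classPolynomial (−51)`.
[cite: Ishii2004, §3 (table h(R) = 2, row d(R) = −51: `x² + 5541101568x + 6262062317568`, held text p. 5 line 68)] -/
theorem classPolynomial_neg_51 :
    classPolynomial (-51) = X ^ 2 + C (5541101568 : ℂ) * X + C (6262062317568 : ℂ) := by
  rw [classPolynomial, reducedForms_neg_51, Finset.prod_pair (by decide)]
  obtain ⟨hs, hp⟩ := formJ_add_and_mul
  calc (X - C (formJ (1, 1, 13))) * (X - C (formJ (3, 3, 5)))
      = X ^ 2 - C (formJ (1, 1, 13) + formJ (3, 3, 5)) * X + C (formJ (1, 1, 13) * formJ (3, 3, 5)) := by rw [C_add, C_mul]; ring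
    _ = X ^ 2 + C (5541101568 : ℂ) * X + C (6262062317568 : ℂ) := by rw [hs, hp, C_neg]; ring

/-- `H_{−51}(x) = x² + 5541101568x + 6262062317568` for every `x ∈ ℂ`. [cite: Ishii2004, §3 (row d(R) = −51)] -/
theorem classPolynomial_neg_51_eval (x : ℂ) :
    (classPolynomial (-51)).eval x = x ^ 2 + 5541101568 * x + 6262062317568 := by
  rw [classPolynomial_neg_51]
  simp only [eval_add, eval_mul, eval_pow, eval_X, eval_C]

/-- **`H_{−51}(0) = 6262062317568 = 18432³`** (`18432 = 2¹¹·3²`; the norm of `j` is a cube). [cite: Ishii2004, §3 (row d(R) = −51)] -/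
theorem classPolynomial_neg_51_eval_zero : (classPolynomial (-51)).eval 0 = 18432 ^ 3 := by
  rw [classPolynomial_neg_51_eval]; norm_num

/-- **`H_{−51}(1728) = 15837088813056 = 3979584² = (2⁶·3³·7²·47)²`** (the norm of `j − 1728` is a square). [cite: Ishii2004, §3 (row d(R) = −51)] -/
theorem classPolynomial_neg_51_eval_1728 : (classPolynomial (-51)).eval 1728 = 3979584 ^ 2 := by
  rw [classPolynomial_neg_51_eval]; norm_num

/-- **`j(𝒪_K) = −2770550784 − 671956992√17` for `K = ℚ(√−51)`**: the `j`-invariant of `𝒪_K = ℤ[(1+√−51)/2]` (the tree's `cmPeriodPair (−51)`),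
via `formJ_principalForm`. [cite: Ishii2004, §3 (row d(R) = −51: `−2770550784 − 671956992√17`, held text p. 5 line 70)] -/
theorem j_cmPeriodPair_neg_51 : (cmPeriodPair (-51)).j = -2770550784 - 671956992 * (√(17 : ℝ) : ℂ) := by
  have hP : Literature.NumberTheory.QuadraticFields.BinaryQuadraticForm.principalForm (-51) = ((1 : ℤ), (1 : ℤ), (13 : ℤ)) := by decide
  rw [← formJ_principalForm (D := -51) (by norm_num) (by norm_num), hP, formJ_one_one_thirteen_eq]

end Literature.NumberTheory.EllipticCurves

end
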